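import Literature.NumberTheory.EllipticCurves.TunnellHalfIntegralFormsProofs
import Literature.NumberTheory.EllipticCurves.HalfIntegralWeightFormsThetaMultiplierProofs
import Literature.NumberTheory.EllipticCurves.HalfIntegralWeightThetaMultiplier
import HarnessLib

/-!
# Theta-automorphy of Tunnell's forms `g θ_t` of weight `3/2` and level `128`

First half of the membership `g θ₂, g θ₈ ∈ S_{3/2}(128, 1)` (and `g θ₄, g θ₁₆ ∈ S_{3/2}(128, χ₂)`)
asserted by Tunnell 1983, p. 327 ("a basis for the space of cusp forms of weight `3/2`, level
`128` and trivial character is `{g θ₂, g θ₈, g θ₃₂}`. Similarly, `{g θ₁, g θ₄, g θ₁₆}` is a basis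
for … character `χ₈`"), which is the cusp-form half of Theorem 2
(`Tunnell1983_thm2_triv/chi2` in `TunnellHalfIntegralForms`) and the condition (M) of
`Tunnell1983_waldspurger_triv_iff` (`TunnellHalfIntegralFormsProofs`). Of the three membership
conditions of `halfIntCuspForms 3 128 χ` (`mem_halfIntCuspForms_iff`) — holomorphy, theta-automorphy
(`IsThetaAutomorphic 3 128 χ`), vanishing at all cusps — the first is `mdifferentiable_tunnellForm`
and the second is PROVED here for all six forms `g θ_t`, `t ∣ 32`:

* `isThetaAutomorphic_tunnellForm_two/eight/thirtytwo` — trivial character;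
* `isThetaAutomorphic_tunnellForm_one/four/sixteen` — character `χ₂ = tunnellChar`.

## Proof

By `two_mul_tunnellForm_eq`, `2 g θ_t = (θ₁ - θ₄)(2 θ₃₂ - θ₈) θ_t` with `θ_s(z) = θ(sz)`
(`thetaMul_eq_shimuraTheta`, `θ = shimuraTheta`). For `γ = (a b; c d) ∈ SL₂(ℤ)` with `4s ∣ c` one
has `s · γz = γ_s (sz)` with `γ_s = (a, sb; c/s, d) ∈ Γ₀(4)` (`exists_divLower`), so the
transformation law of `θ` on `Γ₀(4)` (`shimuraTheta_smul_eq_thetaFactor`,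
`HalfIntegralWeightFormsThetaMultiplierProofs`) gives

  `θ_s(γz) = j(γ_s, sz) θ_s(z) = (s/|d|) · j(γ, z) · θ_s(z)`      (`thetaMul_smul`)

since `ε_d⁻¹ (c/s / d) √((c/s)(sz) + d) = (s/|d|) ε_d⁻¹ (c/d) √(cz + d)` (multiplicativity of the
Jacobi symbol, `thetaFactor_eq_mul_divLower`). For `γ ∈ Γ₀(128)` all of `4, 16, 32, 128, 4t`
divide `c`, `|d|` is odd, `(1/|d|) = (4/|d|) = 1` and `(8/|d|) = (32/|d|) = (2/|d|)`, whence

  `(g θ_t)(γz) = (2t/|d|) · j(γ, z)³ · (g θ_t)(z)`                 (`tunnellForm_smul`)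

and, multiplying by `θ(z)³` and using `θ(γz) = j(γ, z) θ(z)` once more, the automorphy
`(g θ_t)(γz) θ(z)³ = χ(d) θ(γz)³ (g θ_t)(z)` with `χ(d) = (2t/|d|)`: trivial for `t = 2, 8, 32`
(`(4/·) = (16/·) = (64/·) = 1`) and `χ₈(d) = tunnellChar d` for `t = 1, 4, 16`
(`tunnellChar_apply_of_odd`, `jacobiSym.at_two`).

## References

* J. B. Tunnell, *A classical Diophantine problem and modular forms of weight 3/2*, Invent. Math.
  72 (1983) 323–334, p. 326 (`θ_t ∈ M_{1/2}(4t, χ_t)`), p. 327 ll. 13–18 (the forms `g θ_t` and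
  their characters). [Tunnell1983Congruent]
* G. Shimura, *On modular forms of half integral weight*, Ann. of Math. 97 (1973) 440–481, §1
  (`j(γ, z)`), Prop. 2.2 (theta series of weight `1/2`). [Shimura1973HalfIntegral]
-/

noncomputable section

open UpperHalfPlane hiding I
open Complex ModularGroup Matrix.SpecialLinearGroup CongruenceSubgroup
open scoped MatrixGroups Real NumberTheorySymbols

namespace Literature.NumberTheory.EllipticCurves.ModularForms

open Literature.NumberTheory.EllipticCurves.Tunnell1983 (mul_im_pos)

/-! ### The points `s z` and the matrices `γ_s = (a, s b; c/s, d)` -/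

/-- `((c/s : ℤ) : ℂ) * s = c` for `s ∣ c`. [folklore] -/
theorem cast_ediv_mul (s : ℕ) {c : ℤ} (h : (s : ℤ) ∣ c) : ((c / s : ℤ) : ℂ) * (s : ℂ) = c := by
  have := Int.ediv_mul_cancel h
  exact_mod_cast this

/-- `c z + d ≠ 0` for the bottom row `(c, d)` of any `γ ∈ SL₂(ℤ)` and `z ∈ ℍ`. [folklore] -/
theorem sl_denom_ne_zero (γ : SL(2, ℤ)) (z : ℍ) : (γ 1 0 : ℂ) * z + γ 1 1 ≠ 0 := by
  have hne : ((![((γ 1 0 : ℤ) : ℝ), ((γ 1 1 : ℤ) : ℝ)] 0 : ℝ) : ℂ) * z +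
      (![((γ 1 0 : ℤ) : ℝ), ((γ 1 1 : ℤ) : ℝ)] 1 : ℝ) ≠ 0 := by
    apply UpperHalfPlane.linear_ne_zero
    intro hcd
    have hc : ((γ 1 0 : ℤ) : ℝ) = 0 := by simpa using congrFun hcd 0
    have hd : ((γ 1 1 : ℤ) : ℝ) = 0 := by simpa using congrFun hcd 1
    have h1 := det_eq_one' γ
    rw [show (γ 1 0 : ℤ) = 0 by exact_mod_cast hc, show (γ 1 1 : ℤ) = 0 by exact_mod_cast hd] at h1
    simp at h1
  simpa using hne

/-- **The matrix `γ_s = (a, s b; c/s, d) ∈ SL₂(ℤ)`** for `γ = (a b; c d)` with `s ∣ c`, and the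
relation **`s · γz = γ_s (sz)`** in `ℍ`. [folklore] -/
theorem exists_divLower {s : ℕ} (hs : 0 < s) (γ : SL(2, ℤ)) (h : (s : ℤ) ∣ γ 1 0) :
    ∃ γ' : SL(2, ℤ), γ' 1 0 = γ 1 0 / s ∧ γ' 1 1 = γ 1 1 ∧
      ∀ z : ℍ, UpperHalfPlane.mk ((s : ℂ) * (γ • z : ℍ)) (mul_im_pos hs _) =
        γ' • UpperHalfPlane.mk ((s : ℂ) * z) (mul_im_pos hs z) := by
  refine ⟨⟨!![γ 0 0, s * γ 0 1; γ 1 0 / s, γ 1 1], ?_⟩, rfl, rfl, fun z ↦ ?_⟩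
  · rw [Matrix.det_fin_two_of]
    have h1 := det_eq_one' γ
    have h2 : γ 1 0 / s * s = γ 1 0 := Int.ediv_mul_cancel h
    linear_combination h1 - (γ 0 1) * h2
  · set γ' : SL(2, ℤ) := ⟨!![γ 0 0, s * γ 0 1; γ 1 0 / s, γ 1 1], by
      rw [Matrix.det_fin_two_of]
      have h1 := det_eq_one' γ
      have h2 : γ 1 0 / s * s = γ 1 0 := Int.ediv_mul_cancel h
      linear_combination h1 - (γ 0 1) * h2⟩ with hγ'
    have e00 : (γ' 0 0 : ℤ) = γ 0 0 := rfl
    have e01 : (γ' 0 1 : ℤ) = s * γ 0 1 := rfl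
    have e10 : (γ' 1 0 : ℤ) = γ 1 0 / s := rfl
    have e11 : (γ' 1 1 : ℤ) = γ 1 1 := rfl
    apply UpperHalfPlane.ext
    have eγz : ((UpperHalfPlane.mk ((s : ℂ) * ↑(γ • z)) (mul_im_pos hs (γ • z)) : ℍ) : ℂ) =
        (s : ℂ) * ↑(γ • z) := rfl
    have ez : ((UpperHalfPlane.mk ((s : ℂ) * z) (mul_im_pos hs z) : ℍ) : ℂ) = (s : ℂ) * z := rfl
    rw [eγz, coe_smul_eq' γ', ez, e00, e01, e10, e11, coe_smul_eq' γ]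
    push_cast
    have hs0 : (s : ℂ) ≠ 0 := by exact_mod_cast hs.ne'
    have hden : (γ 1 0 : ℂ) * z + γ 1 1 ≠ 0 := sl_denom_ne_zero γ z
    have hc : ((γ 1 0 / s : ℤ) : ℂ) * ((s : ℂ) * z) = (γ 1 0 : ℂ) * z := by
      rw [← mul_assoc, cast_ediv_mul s h]
    rw [hc]
    field_simp

/-! ### The symbol `(c/d)` and the factor `j(γ, z)` under `c ↦ c/s`, `z ↦ s z` -/

/-- `(c/d) = (c/s / d) · (s/|d|)` for `s ≥ 1`, `s ∣ c` (multiplicativity of the Jacobi symbol; the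
sign conventions of Shimura's symbol agree since `c` and `c/s` have the same sign). [folklore] -/
theorem shimuraSymbol_eq_mul_jacobiSym {s : ℕ} (hs : 0 < s) {c : ℤ} (h : (s : ℤ) ∣ c) (d : ℤ) :
    shimuraSymbol c d = shimuraSymbol (c / s) d * J(s | d.natAbs) := by
  unfold shimuraSymbol
  obtain ⟨c', hc'⟩ := h
  have hs0 : (s : ℤ) ≠ 0 := by exact_mod_cast hs.ne'
  have hcs : c / s = c' := by rw [hc', Int.mul_ediv_cancel_left _ hs0]
  have hsign : (c < 0 ∧ d < 0) ↔ (c' < 0 ∧ d < 0) := by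
    rw [hc']
    constructor
    · rintro ⟨h1, h2⟩
      refine ⟨?_, h2⟩
      by_contra hle
      push Not at hle
      have : 0 ≤ (s : ℤ) * c' := mul_nonneg (by positivity) hle
      exact absurd h1 (not_lt.mpr this)
    · rintro ⟨h1, h2⟩
      exact ⟨mul_neg_of_pos_of_neg (by exact_mod_cast hs) h1, h2⟩
  rw [hc'] at hsign
  rw [hcs, hc', jacobiSym.mul_left]
  by_cases hneg : c' < 0 ∧ d < 0
  · rw [if_pos hneg, if_pos (hsign.mpr hneg)]; ring
  · rw [if_neg hneg, if_neg (fun h' ↦ hneg (hsign.mp h'))]; ring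

/-- **`j(γ, z) = (s/|d|) · j(γ_s, s z)`** for `γ_s = (a, s b; c/s, d)`:
`ε_d⁻¹ (c/d) √(cz + d) = (s/|d|) · ε_d⁻¹ (c/s / d) √((c/s)(sz) + d)`. [folklore] -/
theorem thetaFactor_eq_mul_divLower {s : ℕ} (hs : 0 < s) {c : ℤ} (h : (s : ℤ) ∣ c) (d : ℤ) (z : ℍ) :
    thetaFactor c d z = (J(s | d.natAbs) : ℂ) *
      thetaFactor (c / s) d (UpperHalfPlane.mk ((s : ℂ) * z) (mul_im_pos hs z)) := by
  unfold thetaFactor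
  have ez : ((UpperHalfPlane.mk ((s : ℂ) * z) (mul_im_pos hs z) : ℍ) : ℂ) = (s : ℂ) * z := rfl
  rw [ez, ← mul_assoc ((c / s : ℤ) : ℂ), cast_ediv_mul s h,
    shimuraSymbol_eq_mul_jacobiSym hs h d]
  push_cast
  ring

/-- `(s/|d|)² = 1` when `s ∣ c` and `gcd(c, d) = 1` (e.g. `(c, d)` the bottom row of `γ ∈ SL₂(ℤ)`).
[folklore] -/
theorem jacobiSym_sq_eq_one_of_dvd {s : ℕ} {c d : ℤ} (h : (s : ℤ) ∣ c) (hcd : Int.gcd c d = 1) :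
    J(s | d.natAbs) ^ 2 = 1 := by
  apply jacobiSym.sq_one
  have h1 : Nat.Coprime c.natAbs d.natAbs := hcd
  have h2 : s ∣ c.natAbs := by
    have := Int.natAbs_dvd_natAbs.mpr h
    simpa using this
  have h3 : Nat.Coprime s d.natAbs := Nat.Coprime.coprime_dvd_left h2 h1
  have h4 : Int.gcd (s : ℤ) (d.natAbs : ℤ) = Nat.gcd s d.natAbs := by
    simp [Int.gcd, Int.natAbs_abs]
  rw [h4]
  exact h3

end Literature.NumberTheory.EllipticCurves.ModularForms

namespace Literature.NumberTheory.EllipticCurves.Tunnell1983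

open Literature.NumberTheory.EllipticCurves.ModularForms

/-! ### The transformation law of `θ_s(z) = θ(sz)` on `Γ₀(4s)` -/

/-- **The transformation law of `θ_s(z) = θ(sz)`** ("`θ_t` is a modular form of weight `1/2`,
level `4t` and character `χ_t`", Tunnell p. 326; Shimura 1973, Prop. 2.2 specialised): for
`γ = (a b; c d) ∈ SL₂(ℤ)` with `4s ∣ c` (any sign of `c`),
`θ_s(γz) = (s/|d|) · j(γ, z) · θ_s(z)`, `j(γ, z) = ε_d⁻¹ (c/d) √(cz + d)` (`thetaFactor`), because
`s · γz = γ_s (sz)` with `γ_s = (a, sb; c/s, d) ∈ Γ₀(4)` and `j(γ_s, sz) = (s/|d|) j(γ, z)`.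
[cite: Tunnell1983Congruent, p. 326] [cite: Shimura1973HalfIntegral, §2] -/
theorem thetaMul_smul {s : ℕ} (hs : 0 < s) {γ : SL(2, ℤ)} (h : (4 * s : ℤ) ∣ γ 1 0) (z : ℍ) :
    thetaMul s (γ • z) =
      (J(s | (γ 1 1).natAbs) : ℂ) * thetaFactor (γ 1 0) (γ 1 1) z * thetaMul s z := by
  have hsd : (s : ℤ) ∣ γ 1 0 := (Dvd.intro_left _ rfl : (s : ℤ) ∣ 4 * s).trans h
  obtain ⟨γ', h10, h11, hpt⟩ := exists_divLower hs γ hsd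
  have h4 : γ' ∈ Gamma0 4 := by
    rw [Gamma0_mem, h10]
    obtain ⟨c', hc'⟩ := h
    have hs0 : (s : ℤ) ≠ 0 := by exact_mod_cast hs.ne'
    have : γ 1 0 / s = 4 * c' := by
      rw [hc', show (4 * (s : ℤ)) * c' = s * (4 * c') by ring, Int.mul_ediv_cancel_left _ hs0]
    rw [this]
    push_cast
    rw [show (4 : ZMod 4) = 0 from rfl, zero_mul]
  rw [thetaMul_eq_shimuraTheta hs, thetaMul_eq_shimuraTheta hs, hpt z,
    shimuraTheta_smul_eq_thetaFactor (dvd_refl 4) h4, h10, h11]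
  have hJ : (J(s | (γ 1 1).natAbs) : ℂ) ^ 2 = 1 := by
    exact_mod_cast jacobiSym_sq_eq_one_of_dvd hsd (gcd_c_d_eq_one γ)
  have key := thetaFactor_eq_mul_divLower hs hsd (γ 1 1) z
  have : thetaFactor (γ 1 0 / s) (γ 1 1) (UpperHalfPlane.mk ((s : ℂ) * z) (mul_im_pos hs z)) =
      (J(s | (γ 1 1).natAbs) : ℂ) * thetaFactor (γ 1 0) (γ 1 1) z := by
    rw [key, ← mul_assoc, ← sq, hJ, one_mul]
  rw [this]

/-! ### Jacobi symbols at odd `n` -/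

/-- `(2/n)² = 1`-type facts for odd `n`: `gcd(2, n) = 1`. [folklore] -/
theorem int_gcd_two_eq_one {n : ℕ} (hn : Odd n) : (2 : ℤ).gcd n = 1 := by
  rw [Int.gcd_eq_natAbs]
  simpa using Nat.coprime_two_left.mpr hn

/-- `(4ᵏ a / n) = (a/n)` for odd `n`. [folklore] -/
theorem jacobiSym_four_pow_mul {n : ℕ} (hn : Odd n) (k : ℕ) (a : ℤ) : J(4 ^ k * a | n) = J(a | n) := by
  rw [jacobiSym.mul_left, jacobiSym.pow_left, jacobiSym.at_four hn, one_pow, one_mul]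

/-- `(8/n) = (2/n)` for odd `n`. [folklore] -/
theorem jacobiSym_eight {n : ℕ} (hn : Odd n) : J(8 | n) = J(2 | n) := by
  simpa using jacobiSym_four_pow_mul hn 1 2

/-- `(32/n) = (2/n)` for odd `n`. [folklore] -/
theorem jacobiSym_thirtytwo {n : ℕ} (hn : Odd n) : J(32 | n) = J(2 | n) := by
  simpa using jacobiSym_four_pow_mul hn 2 2

/-- `(16/n) = 1` for odd `n`. [folklore] -/
theorem jacobiSym_sixteen {n : ℕ} (hn : Odd n) : J(16 | n) = 1 := by
  simpa using jacobiSym_four_pow_mul hn 2 1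

/-- `(64/n) = 1` for odd `n`. [folklore] -/
theorem jacobiSym_sixtyfour {n : ℕ} (hn : Odd n) : J(64 | n) = 1 := by
  simpa using jacobiSym_four_pow_mul hn 3 1

/-! ### Automorphy of `g θ_t` under `Γ₀(128)` -/

/-- For `γ ∈ Γ₀(N)` with `N` even, `d` is odd (`ad - bc = 1`, `c` even). [folklore] -/
theorem odd_d_of_even_c {γ : SL(2, ℤ)} (hc : Even (γ 1 0 : ℤ)) : Odd (γ 1 1 : ℤ) := by
  have h1 := det_eq_one' γ
  have hodd : Odd ((γ 0 0 : ℤ) * γ 1 1) := by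
    have : (γ 0 0 : ℤ) * γ 1 1 = γ 0 1 * γ 1 0 + 1 := by linear_combination h1
    rw [this]
    exact (hc.mul_left _).add_one
  exact (Int.odd_mul.mp hodd).2

/-- **Automorphy of `g θ_t`**: for `γ = (a b; c d) ∈ SL₂(ℤ)` with `128 ∣ c` and `4t ∣ c`,
`(g θ_t)(γz) = (2t/|d|) · j(γ, z)³ · (g θ_t)(z)`. From `2 g θ_t = (θ₁ - θ₄)(2 θ₃₂ - θ₈) θ_t` and
the laws `θ_s(γz) = (s/|d|) j(γ, z) θ_s(z)` (`(1/·) = (4/·) = 1`, `(8/·) = (32/·) = (2/·)` at the odd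
`|d|`). [cite: Tunnell1983Congruent, p. 327, ll. 13–16] -/
theorem tunnellForm_smul {t : ℕ} [NeZero t] {γ : SL(2, ℤ)} (h128 : (128 : ℤ) ∣ γ 1 0)
    (ht : (4 * t : ℤ) ∣ γ 1 0) (z : ℍ) :
    tunnellForm t (γ • z) =
      (J(2 * t | (γ 1 1).natAbs) : ℂ) * thetaFactor (γ 1 0) (γ 1 1) z ^ 3 * tunnellForm t z := by
  have hn : Odd (γ 1 1 : ℤ).natAbs := by
    rw [Int.natAbs_odd]
    apply odd_d_of_even_c
    exact (show (2 : ℤ) ∣ 128 by norm_num).trans h128 |> even_iff_two_dvd.mpr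
  have h1 : (4 * (1 : ℕ) : ℤ) ∣ γ 1 0 := (show (4 * (1 : ℕ) : ℤ) ∣ 128 by norm_num).trans h128
  have h4 : (4 * (4 : ℕ) : ℤ) ∣ γ 1 0 := (show (4 * (4 : ℕ) : ℤ) ∣ 128 by norm_num).trans h128
  have h8 : (4 * (8 : ℕ) : ℤ) ∣ γ 1 0 := (show (4 * (8 : ℕ) : ℤ) ∣ 128 by norm_num).trans h128
  have h32 : (4 * (32 : ℕ) : ℤ) ∣ γ 1 0 := (show (4 * (32 : ℕ) : ℤ) ∣ 128 by norm_num).trans h128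
  have e1 := two_mul_tunnellForm_eq t (γ • z)
  have e0 := two_mul_tunnellForm_eq t z
  rw [thetaMul_smul one_pos h1, thetaMul_smul (by norm_num) h4, thetaMul_smul (by norm_num) h8,
    thetaMul_smul (by norm_num) h32, thetaMul_smul (Nat.pos_of_ne_zero (NeZero.ne t)) ht] at e1
  set n : ℕ := (γ 1 1 : ℤ).natAbs with hn_def
  have hJ1 : (J((1 : ℕ) | n) : ℂ) = 1 := by rw [Nat.cast_one, jacobiSym.one_left]; simp
  have hJ4 : (J((4 : ℕ) | n) : ℂ) = 1 := by
    rw [show ((4 : ℕ) : ℤ) = 4 by norm_num, jacobiSym.at_four hn]; simp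
  have hJ8 : (J((8 : ℕ) | n) : ℂ) = J(2 | n) := by
    rw [show ((8 : ℕ) : ℤ) = 8 by norm_num, jacobiSym_eight hn]
  have hJ32 : (J((32 : ℕ) | n) : ℂ) = J(2 | n) := by
    rw [show ((32 : ℕ) : ℤ) = 32 by norm_num, jacobiSym_thirtytwo hn]
  have hJ2t : (J(2 * t | n) : ℂ) = J(2 | n) * J(t | n) := by
    rw [jacobiSym.mul_left]; push_cast; ring
  rw [hJ1, hJ4, hJ8, hJ32] at e1
  rw [hJ2t]
  set j := thetaFactor (γ 1 0) (γ 1 1) z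
  linear_combination (1 / 2 : ℂ) * e1 - (1 / 2 : ℂ) * (J(2 | n) : ℂ) * (J(t | n) : ℂ) * j ^ 3 * e0

/-- **Theta-automorphy of `g θ_t` of weight `3/2` and level `128`** with the character
`d ↦ (2t/|d|)`: if `4t ∣ 128` and `χ(d) = (2t/|d|)` for odd `d`, then
`(g θ_t)(γz) θ(z)³ = χ(d) θ(γz)³ (g θ_t)(z)` for all `γ ∈ Γ₀(128)` (`θ(γz) = j(γ, z) θ(z)`).
[cite: Tunnell1983Congruent, p. 327, ll. 13–16] -/
theorem isThetaAutomorphic_tunnellForm {t : ℕ} [NeZero t] (ht : (4 * t : ℤ) ∣ 128)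
    {χ : DirichletCharacter ℂ 128}
    (hχ : ∀ d : ℤ, Odd d → χ (d : ZMod 128) = (J(2 * t | d.natAbs) : ℂ)) :
    IsThetaAutomorphic 3 128 χ (tunnellForm t) := by
  intro γ hγ z
  have h128 : (128 : ℤ) ∣ γ 1 0 := dvd_entry_of_mem_Gamma0 128 hγ
  have hd : Odd (γ 1 1 : ℤ) :=
    odd_d_of_even_c (even_iff_two_dvd.mpr ((show (2 : ℤ) ∣ 128 by norm_num).trans h128))
  rw [tunnellForm_smul h128 (ht.trans h128) z,
    shimuraTheta_smul_eq_thetaFactor (by norm_num : 4 ∣ 128) hγ z, hχ _ hd]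
  ring

/-- Odd integers are units modulo `128`. [folklore] -/
theorem isUnit_zmod_of_odd {d : ℤ} (hd : Odd d) : IsUnit ((d : ℤ) : ZMod 128) := by
  rw [ZMod.coe_int_isUnit_iff_isCoprime, Int.isCoprime_iff_gcd_eq_one, Int.gcd_eq_natAbs]
  have h2 : Nat.Coprime 2 d.natAbs := Nat.coprime_two_left.mpr (Int.natAbs_odd.mpr hd)
  simpa using (Nat.Coprime.pow_left 7 h2)

/-- **`g θ₂`, `g θ₈`, `g θ₃₂` are theta-automorphic of weight `3/2`, level `128` and trivial
character** (`(4/·) = (16/·) = (64/·) = 1`). [cite: Tunnell1983Congruent, p. 327, ll. 13–17] -/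
theorem isThetaAutomorphic_tunnellForm_two : IsThetaAutomorphic 3 128 1 (tunnellForm 2) := by
  refine isThetaAutomorphic_tunnellForm (by norm_num) fun d hd ↦ ?_
  rw [MulChar.one_apply (isUnit_zmod_of_odd hd), show (2 * (2 : ℕ) : ℤ) = 4 by norm_num,
    jacobiSym.at_four (Int.natAbs_odd.mpr hd)]
  simp

/-- **`g θ₈` is theta-automorphic of weight `3/2`, level `128`, trivial character** (`(16/·) = 1`).
[cite: Tunnell1983Congruent, p. 327, ll. 13–17] -/
theorem isThetaAutomorphic_tunnellForm_eight : IsThetaAutomorphic 3 128 1 (tunnellForm 8) := by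
  refine isThetaAutomorphic_tunnellForm (by norm_num) fun d hd ↦ ?_
  rw [MulChar.one_apply (isUnit_zmod_of_odd hd), show (2 * (8 : ℕ) : ℤ) = 16 by norm_num,
    jacobiSym_sixteen (Int.natAbs_odd.mpr hd)]
  simp

/-- **`g θ₃₂` is theta-automorphic of weight `3/2`, level `128`, trivial character** (`(64/·) = 1`).
[cite: Tunnell1983Congruent, p. 327, ll. 13–17] -/
theorem isThetaAutomorphic_tunnellForm_thirtytwo : IsThetaAutomorphic 3 128 1 (tunnellForm 32) := by
  refine isThetaAutomorphic_tunnellForm (by norm_num) fun d hd ↦ ?_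
  rw [MulChar.one_apply (isUnit_zmod_of_odd hd), show (2 * (32 : ℕ) : ℤ) = 64 by norm_num,
    jacobiSym_sixtyfour (Int.natAbs_odd.mpr hd)]
  simp

/-- `χ₈` is even: `χ₈(-x) = χ₈(x)`. [folklore] -/
theorem χ₈_neg (x : ZMod 8) : ZMod.χ₈ (-x) = ZMod.χ₈ x := by
  decide +revert

/-- `χ₈(|d|) = χ₈(d)`. [folklore] -/
theorem χ₈_natAbs (d : ℤ) : ZMod.χ₈ ((d.natAbs : ℕ) : ZMod 8) = ZMod.χ₈ ((d : ℤ) : ZMod 8) := by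
  have h1 : ((d.natAbs : ℕ) : ZMod 8) = ((d.natAbs : ℤ) : ZMod 8) := by simp
  rw [h1]
  rcases Int.natAbs_eq d with h | h
  · rw [← h]
  · have h2 : (d.natAbs : ℤ) = -d := by linarith
    rw [h2, Int.cast_neg, χ₈_neg]

/-- **`tunnellChar d = (2/|d|)`** for odd `d`: the level-`128` character `χ₂` of Tunnell is
`d ↦ χ₈(d) = (2/|d|)`. [folklore] -/
theorem tunnellChar_apply_of_odd {d : ℤ} (hd : Odd d) :
    tunnellChar (d : ZMod 128) = (J(2 | d.natAbs) : ℂ) := by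
  obtain ⟨u, hu⟩ := isUnit_zmod_of_odd hd
  rw [tunnellChar, ← hu, DirichletCharacter.changeLevel_eq_cast_of_dvd, MulChar.ringHomComp_apply,
    hu, ZMod.cast_intCast (by norm_num : 8 ∣ 128), jacobiSym.at_two (Int.natAbs_odd.mpr hd),
    χ₈_natAbs]
  simp

/-- **`g θ₁`, `g θ₄`, `g θ₁₆` are theta-automorphic of weight `3/2`, level `128` and character
`χ₂ = tunnellChar`** (`(2t/·) = (2/·)` for `t = 1, 4, 16`). [cite: Tunnell1983Congruent, p. 327, ll. 13–18] -/
theorem isThetaAutomorphic_tunnellForm_one : IsThetaAutomorphic 3 128 tunnellChar (tunnellForm 1) := by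
  refine isThetaAutomorphic_tunnellForm (by norm_num) fun d hd ↦ ?_
  rw [tunnellChar_apply_of_odd hd, show (2 * (1 : ℕ) : ℤ) = 2 by norm_num]

/-- **`g θ₄` is theta-automorphic of weight `3/2`, level `128`, character `χ₂`** (`(8/·) = (2/·)`).
[cite: Tunnell1983Congruent, p. 327, ll. 13–18] -/
theorem isThetaAutomorphic_tunnellForm_four : IsThetaAutomorphic 3 128 tunnellChar (tunnellForm 4) := by
  refine isThetaAutomorphic_tunnellForm (by norm_num) fun d hd ↦ ?_
  rw [tunnellChar_apply_of_odd hd, show (2 * (4 : ℕ) : ℤ) = 8 by norm_num,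
    jacobiSym_eight (Int.natAbs_odd.mpr hd)]

/-- **`g θ₁₆` is theta-automorphic of weight `3/2`, level `128`, character `χ₂`** (`(32/·) = (2/·)`).
[cite: Tunnell1983Congruent, p. 327, ll. 13–18] -/
theorem isThetaAutomorphic_tunnellForm_sixteen :
    IsThetaAutomorphic 3 128 tunnellChar (tunnellForm 16) := by
  refine isThetaAutomorphic_tunnellForm (by norm_num) fun d hd ↦ ?_
  rw [tunnellChar_apply_of_odd hd, show (2 * (16 : ℕ) : ℤ) = 32 by norm_num,
    jacobiSym_thirtytwo (Int.natAbs_odd.mpr hd)]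

end Literature.NumberTheory.EllipticCurves.Tunnell1983
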